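import Summits.BirchSwinnertonDyer.BirchSwinnertonDyer.Theorems.PrintCf2RubinValueTwoCMDivisionFieldAbelian
import Literature.NumberTheory.EllipticCurves.DivisionField
import HarnessLib

/-!
# Division-tower alignment, file 1: INTEGER SCALARS ON THE CYCLIC LAYERS `Mᵢ[p^j]` OF TWO COMPLEMENTARY
# `Γ_K`-STABLE COMPONENTS `E[p^∞] = M₁ ⊕ M₂` — uniqueness mod `p^j`, products, powers, restriction to lower
# layers, the splitting `E[p^j] = M₁[p^j] ⊕ M₂[p^j]` and the fixing criterion for `K(E[p^j])` (generic)

Cell `bsd-print-cf2` (HOME `run/shared/lean/pub/bsd-print-cf2/`), width seat `bsd-line-cf2-p1-w8` g7; `--supports`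
stmt-BirchSwinnertonDyer-23300 (helper).  Piece (claimed 18:01Z, -w7 g9 GO 18:01:17Z): the DIVISION-TOWER ALIGNMENT
residual (T-a)–(T-d) of LEAD's v2.6 `stub_towerDescentT1` = the hypotheses `hF'F hsup hdeg₂ hdeg e he` of -w7 g9's
`T1Adapter.t1_binder_of_tower_facts` (p736536): `K_θ·K̃_n ≤ K(W′_K[4·2ⁿ])` with constant index.  This first file is the
GENERIC layer calculus every later file uses (any field `K`, any Weierstrass curve `W/K`, any prime `p`), in the currency of
the Deuring split print (`DeuringGaloisAction.IsPrimaryComponent`: `Γ_K`-stable components with CYCLIC layers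
`M ⊓ E[p^∞][p^j] = ℤ·g`, `ord g = p^j`) and of -w8 g6's `CMDivisionFieldAbelian.exists_int_forall_smul_eq_of_cyclic_layer`:

* §1 one stable component `M` with cyclic layer `ℤ·g` of order `p^j`: the integer scalar `a` of `σ` (`σ • g = a • g`) is
  unique mod `p^j` (`intCast_eq_intCast_of_zsmul_eq_zsmul`), determines the action on the whole layer
  (`forall_smul_eq_zsmul_of_smul_generator`), is multiplicative in `σ` (`mul_smul_eq_zsmul`, `pow_smul_eq_zsmul`),
  restricts to lower layers (`smul_eq_zsmul_of_le`), and `σ` fixes the layer iff `a ≡ 1 (mod p^j)`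
  (`smul_generator_eq_self_iff`).
* §2 two complementary components `M₁ ⊓ M₂ = ⊥`, `M₁ ⊔ M₂ = ⊤`: every `p^j`-torsion point splits into the two layers
  (`exists_mem_layer_add_mem_layer`), so `σ` fixes `E[p^j]` iff it fixes both layers / both layer generators
  (`forall_smul_geomTorsion_eq_self_iff`, `mem_fixingSubgroupOfModule_geomTorsion_iff_smul_generators`) — the
  level-`p^j` version of -w8 g6's `UpsilonSurjects.forall_smul_geomTorsion_four_eq_self_iff`.
* §3 `ZMod` bookkeeping at `p = 2`: a scalar `≡ ±1 (mod 2^j)`, `j ≥ 2`, is determined by its value mod `4`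
  (`intCast_zmod_two_pow_eq_one_of_eq_one_or_eq_neg_one`).

THEOREMS ONLY (no `def`, no named fact, no `sorry`); Theses-free.  HONEST FRAMING: pure group theory on the geometric
points; closes nothing; beyond-print theorem: no.  No summit statement is proved by this seat; BSD is not proved by any of this.

## References
* [Rubin1999] K. Rubin, *Elliptic curves with complex multiplication and the conjecture of Birch and Swinnerton-Dyer*,
  LNM 1716 (1999), §5 Prop. 5.4, Cor. 5.5, (7) (`E[p^∞] = E[𝔭^∞] ⊕ E[𝔭̄^∞]`, `E[𝔭ᵏ] ≅ 𝒪/𝔭ᵏ` cyclic).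
* [SilvermanAEC2009] J. H. Silverman, *The Arithmetic of Elliptic Curves* (2009), III.§7, VIII.§1 (`K(E[m])`).
-/

-- the summit namespace `Summit.BirchSwinnertonDyer.BirchSwinnertonDyer` repeats the problem name by design (D-0017)
set_option linter.dupNamespace false
set_option autoImplicit false

noncomputable section

open scoped Classical

open Field WeierstrassCurve Literature.NumberTheory.EllipticCurves Literature.NumberTheory.GaloisRepresentations
open Summit.BirchSwinnertonDyer.BirchSwinnertonDyer.Theorems.PrintCf2.CMDivisionFieldAbelian
  (exists_int_forall_smul_eq_of_cyclic_layer)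

namespace Summit.BirchSwinnertonDyer.BirchSwinnertonDyer.Theorems.PrintCf2.CMDivisionTower

variable {K : Type} [Field K] (W : WeierstrassCurve K) (p : ℕ)

/-! ## §1. One stable component with cyclic layers: the integer scalar of `σ` -/

section OneComponent

variable {M : AddSubgroup (geomPrimaryTorsion W p)}

/-- The layers increase: `M[p^j] ≤ M[p^{j'}]` for `j ≤ j'`. [cite: Rubin1999, §5 Prop. 5.4] -/
theorem layer_mono {j j' : ℕ} (h : j ≤ j') :
    M ⊓ AddSubgroup.torsionBy (geomPrimaryTorsion W p) (p ^ j) ≤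
      M ⊓ AddSubgroup.torsionBy (geomPrimaryTorsion W p) (p ^ j') := by
  refine inf_le_inf_left M fun x hx ↦ ?_
  have hx' : ((p : ℤ) ^ j) • x = 0 := by simpa using hx
  show ((p ^ j' : ℕ) : ℤ) • x = 0
  rw [Nat.cast_pow, ← Nat.sub_add_cancel h, pow_add, mul_smul, hx', smul_zero]

/-- The generator of a cyclic layer lies in it (hence in `M`, and is killed by `p^j`). [cite: Rubin1999, §5 Prop. 5.4] -/
theorem generator_mem_layer {j : ℕ} {g : geomPrimaryTorsion W p}
    (hg : M ⊓ AddSubgroup.torsionBy (geomPrimaryTorsion W p) (p ^ j) = AddSubgroup.zmultiples g) :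
    g ∈ M ⊓ AddSubgroup.torsionBy (geomPrimaryTorsion W p) (p ^ j) :=
  hg ▸ AddSubgroup.mem_zmultiples g

/-- `p^j` kills the generator of the layer `M[p^j]`. [cite: Rubin1999, §5 Prop. 5.4] -/
theorem pow_zsmul_generator_eq_zero {j : ℕ} {g : geomPrimaryTorsion W p}
    (hg : M ⊓ AddSubgroup.torsionBy (geomPrimaryTorsion W p) (p ^ j) = AddSubgroup.zmultiples g) :
    ((p : ℤ) ^ j) • g = 0 := by
  simpa using (AddSubgroup.mem_inf.mp (generator_mem_layer W p hg)).2

/-- **Existence of the scalar**: on a `Γ_K`-stable `M` with cyclic layer `M[p^j] = ℤ·g`, `σ • g = a • g` for some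
`a : ℤ`. [cite: Rubin1999, §5 Prop. 5.4, Cor. 5.5] -/
theorem exists_smul_generator_eq_zsmul (hst : ∀ σ : absoluteGaloisGroup K, ∀ x ∈ M, σ • x ∈ M) {j : ℕ}
    {g : geomPrimaryTorsion W p} (hg : M ⊓ AddSubgroup.torsionBy (geomPrimaryTorsion W p) (p ^ j) = AddSubgroup.zmultiples g)
    (σ : absoluteGaloisGroup K) : ∃ a : ℤ, σ • g = a • g := by
  obtain ⟨a, ha⟩ := exists_int_forall_smul_eq_of_cyclic_layer W p hst hg σ
  exact ⟨a, ha g (generator_mem_layer W p hg)⟩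

/-- The scalar on the generator is the scalar on the whole layer `ℤ·g`. [cite: Rubin1999, §5 Cor. 5.5] -/
theorem forall_smul_eq_zsmul_of_smul_generator {j : ℕ} {g : geomPrimaryTorsion W p}
    (hg : M ⊓ AddSubgroup.torsionBy (geomPrimaryTorsion W p) (p ^ j) = AddSubgroup.zmultiples g)
    {σ : absoluteGaloisGroup K} {a : ℤ} (h : σ • g = a • g) :
    ∀ x ∈ M ⊓ AddSubgroup.torsionBy (geomPrimaryTorsion W p) (p ^ j), σ • x = a • x := by
  intro x hx
  rw [hg, AddSubgroup.mem_zmultiples_iff] at hx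
  obtain ⟨c, rfl⟩ := hx
  rw [smul_comm σ c g, h, smul_comm c a g]

/-- `σ` fixes the layer iff it fixes the generator. [cite: Rubin1999, §5 Cor. 5.5] -/
theorem forall_smul_eq_self_iff_smul_generator {j : ℕ} {g : geomPrimaryTorsion W p}
    (hg : M ⊓ AddSubgroup.torsionBy (geomPrimaryTorsion W p) (p ^ j) = AddSubgroup.zmultiples g)
    (σ : absoluteGaloisGroup K) :
    (∀ x ∈ M ⊓ AddSubgroup.torsionBy (geomPrimaryTorsion W p) (p ^ j), σ • x = x) ↔ σ • g = g := by
  refine ⟨fun h ↦ h g (generator_mem_layer W p hg), fun h x hx ↦ ?_⟩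
  have := forall_smul_eq_zsmul_of_smul_generator W p hg (a := 1) (h.trans (one_smul ℤ g).symm) x hx
  rwa [one_smul] at this

/-- **Uniqueness of the scalar mod `p^j`**: for `g` of order `p^j`, `a • g = b • g ↔ a ≡ b (mod p^j)`.
[cite: Rubin1999, §5 Prop. 5.4] -/
theorem zsmul_eq_zsmul_iff_intCast_eq {j : ℕ} {g : geomPrimaryTorsion W p} (hord : addOrderOf g = p ^ j) (a b : ℤ) :
    a • g = b • g ↔ (a : ZMod (p ^ j)) = (b : ZMod (p ^ j)) := by
  rw [← sub_eq_zero, ← sub_smul, ZMod.intCast_eq_intCast_iff_dvd_sub, ← addOrderOf_dvd_iff_zsmul_eq_zero, hord,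
    Nat.cast_pow]
  constructor
  · intro h; rw [← neg_sub]; exact (dvd_neg).mpr h
  · intro h; rw [← neg_sub]; exact (dvd_neg).mpr h

/-- Two scalars of the same `σ` on a generator of order `p^j` agree mod `p^j`. [cite: Rubin1999, §5 Prop. 5.4] -/
theorem intCast_eq_intCast_of_smul_eq_zsmul {j : ℕ} {g : geomPrimaryTorsion W p} (hord : addOrderOf g = p ^ j)
    {σ : absoluteGaloisGroup K} {a b : ℤ} (ha : σ • g = a • g) (hb : σ • g = b • g) :
    (a : ZMod (p ^ j)) = (b : ZMod (p ^ j)) :=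
  (zsmul_eq_zsmul_iff_intCast_eq W p hord a b).mp (ha.symm.trans hb)

/-- Conversely a congruent integer is also a scalar of `σ`. [cite: Rubin1999, §5 Prop. 5.4] -/
theorem smul_eq_zsmul_of_intCast_eq {j : ℕ} {g : geomPrimaryTorsion W p} (hord : addOrderOf g = p ^ j)
    {σ : absoluteGaloisGroup K} {a b : ℤ} (ha : σ • g = a • g) (hab : (a : ZMod (p ^ j)) = (b : ZMod (p ^ j))) :
    σ • g = b • g :=
  ha.trans ((zsmul_eq_zsmul_iff_intCast_eq W p hord a b).mpr hab)

/-- **`σ` fixes the generator iff its scalar is `1 mod p^j`.** [cite: Rubin1999, §5 Prop. 5.4, Cor. 5.5] -/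
theorem smul_generator_eq_self_iff {j : ℕ} {g : geomPrimaryTorsion W p} (hord : addOrderOf g = p ^ j)
    {σ : absoluteGaloisGroup K} {a : ℤ} (ha : σ • g = a • g) : σ • g = g ↔ (a : ZMod (p ^ j)) = 1 := by
  have h := zsmul_eq_zsmul_iff_intCast_eq W p hord a 1
  rw [one_smul, Int.cast_one] at h
  rw [ha, h]

/-- **`σ` negates the generator iff its scalar is `−1 mod p^j`.** [cite: Rubin1999, §5 Prop. 5.4, Cor. 5.5] -/
theorem smul_generator_eq_neg_iff {j : ℕ} {g : geomPrimaryTorsion W p} (hord : addOrderOf g = p ^ j)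
    {σ : absoluteGaloisGroup K} {a : ℤ} (ha : σ • g = a • g) : σ • g = -g ↔ (a : ZMod (p ^ j)) = -1 := by
  have h := zsmul_eq_zsmul_iff_intCast_eq W p hord a (-1)
  rw [neg_one_zsmul, Int.cast_neg, Int.cast_one] at h
  rw [ha, h]

/-- **Multiplicativity**: scalars of `σ` and `τ` multiply to a scalar of `στ`. [cite: Rubin1999, §5 Cor. 5.5] -/
theorem mul_smul_eq_zsmul {g : geomPrimaryTorsion W p} {σ τ : absoluteGaloisGroup K} {a b : ℤ}
    (ha : σ • g = a • g) (hb : τ • g = b • g) : (σ * τ) • g = (a * b) • g := by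
  rw [mul_smul, hb, smul_comm σ b g, ha, smul_smul, mul_comm b a]

/-- **Powers**: if `σ • g = a • g` then `σⁿ • g = aⁿ • g`. [cite: Rubin1999, §5 Cor. 5.5] -/
theorem pow_smul_eq_zsmul {g : geomPrimaryTorsion W p} {σ : absoluteGaloisGroup K} {a : ℤ} (ha : σ • g = a • g)
    (n : ℕ) : (σ ^ n) • g = (a ^ n) • g := by
  induction n with
  | zero => rw [pow_zero, pow_zero, one_smul, one_smul]
  | succ n ih => rw [pow_succ, pow_succ, mul_smul_eq_zsmul W p ih ha]

/-- The scalars of `σ` and `σ⁻¹` are mutually inverse mod `p^j`. [cite: Rubin1999, §5 Cor. 5.5] -/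
theorem intCast_mul_intCast_eq_one_of_inv {j : ℕ} {g : geomPrimaryTorsion W p} (hord : addOrderOf g = p ^ j)
    {σ : absoluteGaloisGroup K} {a b : ℤ} (ha : σ • g = a • g) (hb : σ⁻¹ • g = b • g) :
    ((a * b : ℤ) : ZMod (p ^ j)) = 1 := by
  have h := mul_smul_eq_zsmul W p ha hb
  rw [mul_inv_cancel, one_smul] at h
  have := (zsmul_eq_zsmul_iff_intCast_eq W p hord (a * b) 1).mp h.symm
  rwa [Int.cast_one] at this

/-- **Restriction to a lower layer**: the scalar of `σ` on the generator of `M[p^{j'}]` is also its scalar on the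
generator of `M[p^j]`, `j ≤ j'` (which is a multiple of the former). [cite: Rubin1999, §5 Prop. 5.4] -/
theorem smul_eq_zsmul_of_le {j j' : ℕ} (h : j ≤ j') {g g' : geomPrimaryTorsion W p}
    (hg : M ⊓ AddSubgroup.torsionBy (geomPrimaryTorsion W p) (p ^ j) = AddSubgroup.zmultiples g)
    (hg' : M ⊓ AddSubgroup.torsionBy (geomPrimaryTorsion W p) (p ^ j') = AddSubgroup.zmultiples g')
    {σ : absoluteGaloisGroup K} {a : ℤ} (ha : σ • g' = a • g') : σ • g = a • g :=
  forall_smul_eq_zsmul_of_smul_generator W p hg' ha g (layer_mono W p h (generator_mem_layer W p hg))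

/-- The scalar `a` of any `σ` on a generator of order `p^j`, `j ≠ 0`, is prime to `p` (`σ` is invertible).
[cite: Rubin1999, §5 Cor. 5.5] -/
theorem isUnit_intCast_of_smul_eq_zsmul (hst : ∀ σ : absoluteGaloisGroup K, ∀ x ∈ M, σ • x ∈ M) {j : ℕ}
    {g : geomPrimaryTorsion W p} (hord : addOrderOf g = p ^ j)
    (hg : M ⊓ AddSubgroup.torsionBy (geomPrimaryTorsion W p) (p ^ j) = AddSubgroup.zmultiples g)
    {σ : absoluteGaloisGroup K} {a : ℤ} (ha : σ • g = a • g) : IsUnit (a : ZMod (p ^ j)) := by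
  obtain ⟨b, hb⟩ := exists_smul_generator_eq_zsmul W p hst hg σ⁻¹
  have h := intCast_mul_intCast_eq_one_of_inv W p hord ha hb
  rw [Int.cast_mul] at h
  exact isUnit_iff_exists_inv.mpr ⟨_, h⟩

end OneComponent

/-! ## §2. Two complementary components: `E[p^j] = M₁[p^j] ⊕ M₂[p^j]` and the fixing criterion -/

section TwoComponents

variable (M₁ M₂ : AddSubgroup (geomPrimaryTorsion W p)) (hinf : M₁ ⊓ M₂ = ⊥) (hsup : M₁ ⊔ M₂ = ⊤)

include hinf hsup in
/-- **Every `p^j`-torsion point of `E[p^∞]` splits into the two layers**: `x = x₁ + x₂` with `xᵢ ∈ Mᵢ[p^j]`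
(`x ∈ M₁ + M₂`, and `p^j x₁ = −p^j x₂ ∈ M₁ ⊓ M₂ = 0`). [cite: Rubin1999, §5 (7)] -/
theorem exists_mem_layer_add_mem_layer {j : ℕ} (x : geomPrimaryTorsion W p) (hx : ((p : ℤ) ^ j) • x = 0) :
    ∃ x₁ ∈ M₁ ⊓ AddSubgroup.torsionBy (geomPrimaryTorsion W p) (p ^ j),
      ∃ x₂ ∈ M₂ ⊓ AddSubgroup.torsionBy (geomPrimaryTorsion W p) (p ^ j), x = x₁ + x₂ := by
  have hxmem : x ∈ M₁ ⊔ M₂ := hsup ▸ AddSubgroup.mem_top x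
  obtain ⟨x₁, hx₁, x₂, hx₂, hsum⟩ := AddSubgroup.mem_sup.mp hxmem
  have h1 : ((p : ℤ) ^ j) • x₁ ∈ M₁ ⊓ M₂ := by
    refine AddSubgroup.mem_inf.mpr ⟨M₁.zsmul_mem hx₁ _, ?_⟩
    have : ((p : ℤ) ^ j) • x₁ = -(((p : ℤ) ^ j) • x₂) := by
      rw [eq_neg_iff_add_eq_zero, ← smul_add, hsum, hx]
    rw [this]
    exact M₂.neg_mem (M₂.zsmul_mem hx₂ _)
  rw [hinf, AddSubgroup.mem_bot] at h1
  have h2 : ((p : ℤ) ^ j) • x₂ = 0 := by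
    have : ((p : ℤ) ^ j) • (x₁ + x₂) = 0 := by rw [hsum, hx]
    rwa [smul_add, h1, zero_add] at this
  refine ⟨x₁, AddSubgroup.mem_inf.mpr ⟨hx₁, by simpa using h1⟩, x₂, AddSubgroup.mem_inf.mpr ⟨hx₂, by simpa using h2⟩,
    hsum.symm⟩

include hinf hsup in
/-- **`σ` fixes `E[p^j]` pointwise iff it fixes both layers `M₁[p^j]`, `M₂[p^j]` pointwise.**
[cite: Rubin1999, §5 (7)] [cite: SilvermanAEC2009, VIII.§1] -/
theorem forall_smul_geomTorsion_eq_self_iff (j : ℕ) (σ : absoluteGaloisGroup K) :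
    (∀ T : geomTorsion W ((p ^ j : ℕ) : ℤ), σ • T = T) ↔
      ((∀ x ∈ M₁ ⊓ AddSubgroup.torsionBy (geomPrimaryTorsion W p) (p ^ j), σ • x = x) ∧
        (∀ x ∈ M₂ ⊓ AddSubgroup.torsionBy (geomPrimaryTorsion W p) (p ^ j), σ • x = x)) := by
  -- a point of `E[p^∞]` killed by `p^j`, read as a point of `E[p^j]`
  have key : ∀ x : geomPrimaryTorsion W p, x ∈ AddSubgroup.torsionBy (geomPrimaryTorsion W p) (p ^ j) →
      (∀ T : geomTorsion W ((p ^ j : ℕ) : ℤ), σ • T = T) → σ • x = x := by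
    intro x hx hT
    have hxj : ((p : ℤ) ^ j) • x = 0 := by simpa using hx
    have hx' : ((p ^ j : ℕ) : ℤ) • (x : geomPoints W) = 0 := by
      have := congrArg (fun y : geomPrimaryTorsion W p ↦ (y : geomPoints W)) hxj
      rw [AddSubgroupClass.coe_zsmul, ZeroMemClass.coe_zero] at this
      exact_mod_cast this
    have := congrArg (fun T : geomTorsion W ((p ^ j : ℕ) : ℤ) ↦ (T : geomPoints W)) (hT ⟨x, hx'⟩)
    apply Subtype.ext
    simpa only [AddSubgroup.torsionBy.coe_smul, primaryComponent.coe_smul] using this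
  constructor
  · intro hT
    exact ⟨fun x hx ↦ key x (AddSubgroup.mem_inf.mp hx).2 hT, fun x hx ↦ key x (AddSubgroup.mem_inf.mp hx).2 hT⟩
  · rintro ⟨h₁, h₂⟩ T
    have hTj : ((p ^ j : ℕ) : ℤ) • (T : geomPoints W) = 0 := T.2
    have hTprim : (T : geomPoints W) ∈ geomPrimaryTorsion W p := ⟨j, by rw [natCast_zsmul] at hTj; exact hTj⟩
    set P : geomPrimaryTorsion W p := ⟨T, hTprim⟩ with hP
    have hPj : ((p : ℤ) ^ j) • P = 0 := by
      apply Subtype.ext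
      rw [AddSubgroupClass.coe_zsmul, ZeroMemClass.coe_zero, hP]
      exact_mod_cast hTj
    obtain ⟨x₁, hx₁, x₂, hx₂, hsum⟩ := exists_mem_layer_add_mem_layer W p M₁ M₂ hinf hsup P hPj
    have hσP : σ • P = P := by rw [hsum, smul_add, h₁ x₁ hx₁, h₂ x₂ hx₂]
    apply Subtype.ext
    have := congrArg (fun y : geomPrimaryTorsion W p ↦ (y : geomPoints W)) hσP
    simpa only [AddSubgroup.torsionBy.coe_smul, primaryComponent.coe_smul, hP] using this

include hinf hsup in
/-- **`σ` fixes `E[p^j]` pointwise iff it fixes the two layer generators `g₁`, `g₂`.** [cite: Rubin1999, §5 (7), Prop. 5.4] -/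
theorem forall_smul_geomTorsion_eq_self_iff_smul_generators {j : ℕ} {g₁ g₂ : geomPrimaryTorsion W p}
    (hg₁ : M₁ ⊓ AddSubgroup.torsionBy (geomPrimaryTorsion W p) (p ^ j) = AddSubgroup.zmultiples g₁)
    (hg₂ : M₂ ⊓ AddSubgroup.torsionBy (geomPrimaryTorsion W p) (p ^ j) = AddSubgroup.zmultiples g₂)
    (σ : absoluteGaloisGroup K) :
    (∀ T : geomTorsion W ((p ^ j : ℕ) : ℤ), σ • T = T) ↔ σ • g₁ = g₁ ∧ σ • g₂ = g₂ := by
  rw [forall_smul_geomTorsion_eq_self_iff W p M₁ M₂ hinf hsup j σ, forall_smul_eq_self_iff_smul_generator W p hg₁,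
    forall_smul_eq_self_iff_smul_generator W p hg₂]

include hinf hsup in
/-- **Membership in `Γ_{K(E[p^j])}` read on the layer generators**: `σ ∈ fixingSubgroupOfModule K E[p^j]` iff
`σ • g₁ = g₁` and `σ • g₂ = g₂` (so `K(E[p^j]) = K̄^{{σ : σgᵢ = gᵢ}}`, `WeierstrassCurve.divisionField_def`).
[cite: Rubin1999, §5 (7), Prop. 5.4] [cite: SilvermanAEC2009, VIII.§1] -/
theorem mem_fixingSubgroupOfModule_geomTorsion_iff_smul_generators {j : ℕ} {g₁ g₂ : geomPrimaryTorsion W p}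
    (hg₁ : M₁ ⊓ AddSubgroup.torsionBy (geomPrimaryTorsion W p) (p ^ j) = AddSubgroup.zmultiples g₁)
    (hg₂ : M₂ ⊓ AddSubgroup.torsionBy (geomPrimaryTorsion W p) (p ^ j) = AddSubgroup.zmultiples g₂)
    (σ : absoluteGaloisGroup K) :
    σ ∈ fixingSubgroupOfModule K (geomTorsion W ((p ^ j : ℕ) : ℤ)) ↔ σ • g₁ = g₁ ∧ σ • g₂ = g₂ := by
  rw [W.mem_fixingSubgroupOfModule_geomTorsion_iff, forall_smul_geomTorsion_eq_self_iff_smul_generators W p M₁ M₂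
    hinf hsup hg₁ hg₂]

include hinf hsup in
/-- **Scalar form**: if `σ` acts on the generators by `a₁`, `a₂` (orders `p^j`), then `σ ∈ Γ_{K(E[p^j])}` iff
`a₁ ≡ 1` and `a₂ ≡ 1 (mod p^j)`. [cite: Rubin1999, §5 (7), Prop. 5.4] [cite: SilvermanAEC2009, VIII.§1] -/
theorem mem_fixingSubgroupOfModule_geomTorsion_iff_intCast_eq_one {j : ℕ} {g₁ g₂ : geomPrimaryTorsion W p}
    (hg₁ : M₁ ⊓ AddSubgroup.torsionBy (geomPrimaryTorsion W p) (p ^ j) = AddSubgroup.zmultiples g₁)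
    (hg₂ : M₂ ⊓ AddSubgroup.torsionBy (geomPrimaryTorsion W p) (p ^ j) = AddSubgroup.zmultiples g₂)
    (hord₁ : addOrderOf g₁ = p ^ j) (hord₂ : addOrderOf g₂ = p ^ j)
    {σ : absoluteGaloisGroup K} {a₁ a₂ : ℤ} (ha₁ : σ • g₁ = a₁ • g₁) (ha₂ : σ • g₂ = a₂ • g₂) :
    σ ∈ fixingSubgroupOfModule K (geomTorsion W ((p ^ j : ℕ) : ℤ)) ↔
      (a₁ : ZMod (p ^ j)) = 1 ∧ (a₂ : ZMod (p ^ j)) = 1 := by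
  rw [mem_fixingSubgroupOfModule_geomTorsion_iff_smul_generators W p M₁ M₂ hinf hsup hg₁ hg₂,
    smul_generator_eq_self_iff W p hord₁ ha₁, smul_generator_eq_self_iff W p hord₂ ha₂]

end TwoComponents

/-! ## §3. `ZMod` bookkeeping at `p = 2`: signs are read mod `4` -/

/-- A congruence mod `2^j`, `2 ≤ j`, descends to a congruence mod `4`. [folklore] -/
theorem intCast_zmod_four_eq_of_intCast_zmod_two_pow_eq {j : ℕ} (hj : 2 ≤ j) {a b : ℤ}
    (h : (a : ZMod (2 ^ j)) = (b : ZMod (2 ^ j))) : (a : ZMod (2 ^ 2)) = (b : ZMod (2 ^ 2)) := by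
  rw [ZMod.intCast_eq_intCast_iff_dvd_sub] at h ⊢
  have hdvd : ((2 ^ 2 : ℕ) : ℤ) ∣ ((2 ^ j : ℕ) : ℤ) := Int.natCast_dvd_natCast.mpr (pow_dvd_pow 2 hj)
  exact hdvd.trans h

/-- **A sign mod `2^j` (`j ≥ 2`) is determined mod `4`**: if `a ≡ ±1 (mod 2^j)` and `a ≡ 1 (mod 4)` then
`a ≡ 1 (mod 2^j)`. [folklore] -/
theorem intCast_zmod_two_pow_eq_one_of_eq_one_or_eq_neg_one {j : ℕ} (hj : 2 ≤ j) {a : ℤ}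
    (h : (a : ZMod (2 ^ j)) = 1 ∨ (a : ZMod (2 ^ j)) = -1) (h4 : (a : ZMod (2 ^ 2)) = 1) : (a : ZMod (2 ^ j)) = 1 := by
  rcases h with h | h
  · exact h
  · exfalso
    have h' := intCast_zmod_four_eq_of_intCast_zmod_two_pow_eq hj (b := -1) (by rw [h]; push_cast; rfl)
    rw [h4] at h'
    exact absurd h' (by decide)

/-- Companion: if `a ≡ ±1 (mod 2^j)` and `a ≡ −1 (mod 4)` then `a ≡ −1 (mod 2^j)`. [folklore] -/
theorem intCast_zmod_two_pow_eq_neg_one_of_eq_one_or_eq_neg_one {j : ℕ} (hj : 2 ≤ j) {a : ℤ}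
    (h : (a : ZMod (2 ^ j)) = 1 ∨ (a : ZMod (2 ^ j)) = -1) (h4 : (a : ZMod (2 ^ 2)) = -1) : (a : ZMod (2 ^ j)) = -1 := by
  rcases h with h | h
  · exfalso
    have h' := intCast_zmod_four_eq_of_intCast_zmod_two_pow_eq hj (b := 1) (by rw [h]; push_cast; rfl)
    rw [h4] at h'
    exact absurd h' (by decide)
  · exact h

end Summit.BirchSwinnertonDyer.BirchSwinnertonDyer.Theorems.PrintCf2.CMDivisionTower

end
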